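import Summits.BirchSwinnertonDyer.Rank1Residual.X11b.JetchevChaRoute
import Summits.BirchSwinnertonDyer.Rank1Residual.X11b.ChaPairsMinimality
import Summits.BirchSwinnertonDyer.Rank1Residual.X11b.JetchevChaPairsCards1
import Summits.BirchSwinnertonDyer.Rank1Residual.X11b.JetchevChaPairsCards2
import Summits.BirchSwinnertonDyer.BirchSwinnertonDyer.Theorems.Rank1ResidualX11RankOneReduction
import HarnessLib

/-!
# BSD rank-≤1 residual cell, class X11b: `BSD(E,5)` from PUBLISHED theorems (Miller 2011 Thm. 5.4 in the
# Cha case, FLAGGED) + a two-engine Jetchev–Cha index certificate for the Tamagawa-obstructed RESISTANT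
# pairs of X11 ∧ r = 1 ∧ ¬sst ∧ p ≥ 5 (part 1 of 5)

HONEST FRAMING (cell `b2b-bsdres-*`, verbatim): prove what is provable now; shrink each hard class
to its core with data; no claim beyond stated classes; COMBINATION classes deleted from PUBLISHED
theorems only, CONSTRUCTION-shaped remainder typed; this is not "finishing BSD". Class X11b stays
CONSTRUCTION-SHAPED; everything here is PER PAIR; no lane verdict is changed; no named fact.

Unit `b2b-bsdres-x11c`, gen 4. After gen 3 (Cha route, 24 pairs with `5 ∤ ∏ c_q`), the unit's
RESISTANT list for the `p`-adic certificate route on X11 ∧ `r = 1` ∧ ¬sst ∧ `p ≥ 5`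
(HOME/b2b-bsdres-x11c/RESISTANT.md §A′; `N < 5·10⁵`) consists of 40 pairs at `p = 5` with `ρ̄_{E,5}`
irreducible NOT surjective (`5S4`/`5Ns`), no (ram) witness, and `5 ∣ c_q` at one bad prime `q`
(36×: `q = 5` itself, split `I₅`/`I₁₀`; 5×: a split `I₅` prime `q ∈ {3, 7, 41, 47, 59}`), so that
`5 ∣ [E(K) : ℤ y_K]` in every Heegner field (Gross–Zagier + BSD over `K`). The PRINTED lever is
Jetchev's Tamagawa sharpening in the form of Miller 2011 Thm. 5.4 under the hypotheses of Thm. 5.2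
(Cha) — tree fact `Miller2011.thm54_cha_padicValNat_shaOrder_add_tamagawa_le` (x9 gen 7), FLAGS
`Miller11-Thm54-Cha-case` (printed proof = citation of Jetchev 2008, printed under (\*): `p ∤ N`,
`ρ̄` surjective) and `JET@p|N` (here `p = 5 ∥ N`; the lane's flag, bsdN/HYPOTHESES.md v2) — whose
class-X11b form is `X11b/JetchevChaRoute.lean`. Here, for each certified pair (by increasing conductor):

* the theorem `bsdp_j<label>`: for `W =` Cremona's model (literal a-invariants; NO instance
  hypothesis — `Δ ≠ 0` and global minimality are decided in the kernel, the latter by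
  `isGloballyMinimal_of_krausCriterion_bounded₂`, patterns F2a/F2c/F3 where Silverman's criterion
  fails), the published binders `hMJ`, `hGZK`, the Heegner datum (`K` imaginary quadratic with the
  Heegner hypothesis for the level `N` and `5 ∤ d_K`, `5² ∤ N`, a Heegner point `P` of infinite
  order), ONE prime `q ∣ N` with `ord₅ [E(K) : ℤ P] ≤ ord₅ c_q(E)` (`c_q` = local Tamagawa number of
  `W ⊗ ℚ_q` on its `ℤ_q`-minimal model), `r_an(E) ≤ 1` and `#Ш_an = s` with `ord₅ s = 0` give
  Miller's `BSDp W 5`; multiplicative reduction at `5` (`5 ∣ Δ`, `5 ∤ c₄`) and irreducibility of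
  `E[5]` (Frobenius witness `ℓ`, kernel point count of `JetchevChaPairsCards{1,2}.lean`,
  root-freeness mod `5`) are KERNEL facts (`decide`), through the generic
  `bsdp_of_ainvs_of_jetchevChaCertificate` (part 1, §1).

The numbers left as binders are exactly what two engines certify: `r_an = 1`, `#Ш_an = 1`, the
Tamagawa number `c_q` at the named `q` (engine A: Tate's algorithm, `tateY.py` = unit engine Y
verbatim; engine B: PARI `elllocalred`, job j079111), and the Heegner index in the named field
`K = ℚ(√D)`: engine 1 (cypari2 = X9 gen 7 `jobD1b.py` verbatim; gen-3 jobs j077797/j077800; Miller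
2011 Thm. 4.1 / Cor. 4.8 normalisation, `m = √(4ρ) ∈ ℤ`, `ord₅ m`), engine 2 (stdlib python = X9 gen 7
`eng2` verbatim; gen-3 jobs j077966–j077972, gen-4 job j079105), AGREE on `m`; `ord₅ [E(K) : ℤ y_K] =
ord₅ m` because `E(K)[5] = 0` (`E[5]` irreducible, `[K:ℚ] = 2`) and `m = 2I_K/e`, `e ∈ {1,2}`. Three
pairs of the 40 STAY resistant (`84960d1`, `296240ce1`, `304560by1`: two bad primes with `5 ∥ c_q`,
`ord₅ m = 2` in every field; Jetchev's `max`-form gives only `ord₅ #Ш ≤ 2`, RESISTANT.md §A″).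
Labels certified here (part 1): `3240d1`, `5780c1`, `21660u1`, `23120ba1`, `25920cm1`, `51840bo1`, `52020bk1`, `59040bf1`.

References: R. L. Miller, LMS JCM 14 (2011) Thm. 5.4, Thm. 5.2, Thm. 4.1, Cor. 4.8, Def. 1.1
[Miller2011LMS]; D. Jetchev, Compos. Math. 144 (2008) [Jetchev2008]; B. Cha, J. Number Theory 111
(2005) [Cha2005]; B. Mazur, Invent. Math. 44 (1978) Prop. 6.3 (1) [Mazur1978]; J. H. Silverman, *AEC*
(2009) VII.1, VII.5 [SilvermanAEC2009]; A. Kraus, Acta Arith. 54 (1989) [Kraus1989]; Cremona's tables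
[Cremona2006].
-/

set_option linter.dupNamespace false
set_option autoImplicit false

noncomputable section

open scoped Classical

open WeierstrassCurve Literature.NumberTheory.EllipticCurves
  Literature.NumberTheory.EllipticCurves.Rank1Residual
  Literature.NumberTheory.EllipticCurves.Rank1Residual.X11RankOneCertificates
  Literature.NumberTheory.EllipticCurves.Miller2011
  Summit.BirchSwinnertonDyer.BirchSwinnertonDyer.Rank1Residual.IntModel
  Summit.BirchSwinnertonDyer.BirchSwinnertonDyer.Rank1Residual.X11RankOne

namespace Summit.BirchSwinnertonDyer.Rank1Residual.X11b

/-! ### §1. The certificate shape for a literal integer model -/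

/-- **`BSD(E,p)` from the Jetchev–Cha index certificate for a globally minimal `W/ℚ` with integral model
`[a₁,…,a₆]`, all Galois/reduction hypotheses from DECIDABLE integer data**: `p ∣ Δ`, `p ∤ c₄`
(multiplicative reduction at `p`, hence `E` non-CM), a good prime `ℓ ≠ p` (`ℓ ∤ Δ`) with kernel point
count `#Ẽ(𝔽_ℓ) = n` and `X² − (ℓ + 1 − n)X + ℓ` root-free mod `p` (`E[p]` irreducible, Mazur 1978
Prop. 6.3 (1)); PUBLISHED binders Miller 2011 Thm. 5.4 in the Cha case (`hMJ`, FLAGS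
`Miller11-Thm54-Cha-case`, `JET@p|N`) and GZK (`hGZK`); certificate binders `K` (Heegner for the level
`N`, `p ∤ d_K`), `p² ∤ N`, Heegner point `P` of infinite order, ONE prime `q ∣ N` with
`ord_p [E(K) : ℤ P] ≤ ord_p c_q(E)`, `r_an ≤ 1`, `#Ш_an = s` with `ord_p s = 0`. Composition of
`X11b.bsdp_of_mult_of_jetchevChaCertificate` with the `IntModel` toolkit. Per pair; not a class theorem.
[cite: Miller2011LMS, Thm. 5.4 and Def. 1.1] [cite: Mazur1978, §6 Prop. 6.3 (1) (p. 153)]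
[cite: SilvermanAEC2009, VII.5 Prop. 5.1(b)] -/
theorem bsdp_of_ainvs_of_jetchevChaCertificate (hMJ : thm54_cha_padicValNat_shaOrder_add_tamagawa_le)
    (hGZK : rank_eq_analyticRank_of_analyticRank_le_one) (a1 a2 a3 a4 a6 : ℤ)
    {W : WeierstrassCurve ℚ} [W.IsElliptic] [W.IsGloballyMinimal]
    (hW : integralModelInt W = ⟨a1, a2, a3, a4, a6⟩) (p ℓ n : ℕ) [Fact p.Prime] [Fact ℓ.Prime]
    (hp2 : p ≠ 2) (hpΔ : (p : ℤ) ∣ discOf [a1, a2, a3, a4, a6])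
    (hpc4 : ¬ (p : ℤ) ∣ c4Of [a1, a2, a3, a4, a6]) (hℓp : ℓ ≠ p)
    (hℓΔ : ¬ (ℓ : ℤ) ∣ discOf [a1, a2, a3, a4, a6])
    (hcard : Nat.card (((⟨a1, a2, a3, a4, a6⟩ : WeierstrassCurve ℤ).map
      (Int.castRingHom (ZMod ℓ))).toAffine.Point) = n)
    (hnoroot : ∀ t : ℕ, t < p → ¬ (p : ℤ) ∣ (t : ℤ) ^ 2 - ((ℓ : ℤ) + 1 - n) * t + ℓ)
    {N : ℕ} [NeZero N] {K : Type} [Field K] [NumberField K] (hK : IsImaginaryQuadratic K)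
    (hH : SatisfiesHeegnerHypothesis N K) {P : (W.baseChange K).toAffine.Point}
    (hP : IsHeegnerPoint N W K P) (hnt : ¬ IsOfFinAddOrder P)
    (hpD : ¬ (p : ℤ) ∣ NumberField.discr K) (hpN : ¬ p ^ 2 ∣ N)
    (q : ℕ) [Fact q.Prime] (hqN : q ∣ N)
    (hI : padicValNat p (AddSubgroup.zmultiples P).index ≤
      padicValNat p ((W.baseChange ℚ_[q]).localTamagawaNumber ℤ_[q]))
    (hr : W.analyticRank ≤ 1) {s : ℚ} (hs : shaAn W = (s : ℂ)) (hv : padicValRat p s = 0) :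
    BSDp W p := by
  haveI : NeZero p := ⟨(Fact.out : p.Prime).ne_zero⟩
  have hΔ : (⟨a1, a2, a3, a4, a6⟩ : WeierstrassCurve ℤ).Δ = discOf [a1, a2, a3, a4, a6] :=
    intCurve_Δ a1 a2 a3 a4 a6
  have hc4 : (⟨a1, a2, a3, a4, a6⟩ : WeierstrassCurve ℤ).c₄ = c4Of [a1, a2, a3, a4, a6] :=
    intCurve_c₄ a1 a2 a3 a4 a6
  have hmult : Mult W p :=
    hasMultiplicativeReductionAtPrime_of_intModel hW p (by rw [hΔ]; exact hpΔ) (by rw [hc4]; exact hpc4)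
  have hirr : Irr W p := by
    refine hasIrreducibleModPGaloisRep_of_intModel_of_noroot hW p ℓ hℓp (by rw [hΔ]; exact hℓΔ) hcard
      (forall_zmod_of_forall_lt fun t ht h0 ↦ hnoroot t ht ?_)
    rw [← ZMod.intCast_zmod_eq_zero_iff_dvd]
    push_cast at h0 ⊢
    linear_combination h0
  exact bsdp_of_mult_of_jetchevChaCertificate W p hMJ hGZK hmult hp2 hirr hK hH hP hnt hpD hpN q hqN hI
    hr hs hv

/-! ### §2. Pairs `3240d1`, `5780c1`, `21660u1`, `23120ba1`, `25920cm1`, `51840bo1`, `52020bk1`, `59040bf1` -/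

/-- **`BSD(E,5)` for `3240d1`** (`N = 3240 = 2^3·3^4·5`; `ρ̄_{E,5}` image `5S4`, `split` multiplicative at `5`, additive at
`2`, `3`; Tamagawa numbers `c_2 = 2` (I1*), `c_3 = 3` (IV*), `c_5 = 5` (I5, split), `∏ c_q = 30`) from Miller 2011 Thm. 5.4 in the Cha case (FLAGS
`Miller11-Thm54-Cha-case`, `JET@p|N`) + GZK and the Jetchev–Cha index certificate. Kernel: `Δ ≠ 0`,
global minimality (`isGloballyMinimal_of_krausCriterion_bounded₂`), `5 ∣ Δ ∧ 5 ∤ c₄`, `E[5]` irreducible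
(`ℓ = 7`, `#Ẽ(𝔽_7) = 8`, `a_7 = 0`). Numbers (binders): `r_an ≤ 1`, `#Ш_an` a `5`-adic unit, and the
certificate `ord₅ [E(K) : ℤ y_K] ≤ ord₅ c_q` — intended instance `q = 5` (Kodaira `I5`, split, `c_5 = 5`,
`ord₅ = 1`; engine A = Tate's algorithm `tateY` (engine Y verbatim), engine B = PARI `elllocalred`, job
j079111) and `K = ℚ(√-71)`: `m = √(4ρ) = 60`, `ord₅ m = 1` (engine 1 cypari2 job j077800, `N_{E^D} = 16332840`;
engine 2 stdlib job j077970: `m = 60`, AGREE). Per pair; lane books the verdict (literal tier or PUB, with the flags).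
[cite: Miller2011LMS, Thm. 5.4 and Def. 1.1] [cite: Cremona2006, Table 1 (Cremona label 3240d1)] -/
theorem bsdp_j3240d1 (hMJ : thm54_cha_padicValNat_shaOrder_add_tamagawa_le)
    (hGZK : rank_eq_analyticRank_of_analyticRank_le_one)
    (W : WeierstrassCurve ℚ) (hW : W = ⟨0, 0, 0, -8532, 303156⟩)
    {N : ℕ} [NeZero N] {K : Type} [Field K] [NumberField K] (hK : IsImaginaryQuadratic K)
    (hH : SatisfiesHeegnerHypothesis N K) {P : (W.baseChange K).toAffine.Point}
    (hP : IsHeegnerPoint N W K P) (hnt : ¬ IsOfFinAddOrder P)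
    (hpD : ¬ (5 : ℤ) ∣ NumberField.discr K) (hpN : ¬ 5 ^ 2 ∣ N)
    (q : ℕ) [Fact q.Prime] (hqN : q ∣ N)
    (hI : padicValNat 5 (AddSubgroup.zmultiples P).index ≤
      padicValNat 5 ((W.baseChange ℚ_[q]).localTamagawaNumber ℤ_[q]))
    (hr : W.analyticRank ≤ 1) {s : ℚ} (hs : shaAn W = (s : ℂ)) (hv : padicValRat 5 s = 0) :
    BSDp W 5 := by
  subst hW
  haveI := isElliptic_of_discOf_ne_zero 0 0 0 (-8532) 303156 (by decide +kernel)
  haveI := isGloballyMinimal_of_krausCriterion_bounded₂ 0 0 0 (-8532) 303156 (by decide +kernel) (by decide +kernel)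
    (by decide +kernel)
  haveI : Fact (Nat.Prime 5) := ⟨by norm_num⟩
  haveI : Fact (Nat.Prime 7) := ⟨by norm_num⟩
  exact bsdp_of_ainvs_of_jetchevChaCertificate hMJ hGZK 0 0 0 (-8532) 303156
    (integralModelInt_eq_of_map_eq _ (map_mk_int _ _ _ _ _)) 5 7 8 (by decide) (by decide +kernel)
    (by decide +kernel) (by decide) (by decide +kernel) card_j3240d1_7 (by decide +kernel) hK hH hP hnt
    (mod_cast hpD) hpN q hqN hI hr hs hv

/-- **`BSD(E,5)` for `5780c1`** (`N = 5780 = 2^2·5·17^2`; `ρ̄_{E,5}` image `5S4`, `split` multiplicative at `5`, additive at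
`2`, `17`; Tamagawa numbers `c_2 = 3` (IV*), `c_5 = 5` (I5, split), `c_17 = 1` (II), `∏ c_q = 15`) from Miller 2011 Thm. 5.4 in the Cha case (FLAGS
`Miller11-Thm54-Cha-case`, `JET@p|N`) + GZK and the Jetchev–Cha index certificate. Kernel: `Δ ≠ 0`,
global minimality (`isGloballyMinimal_of_krausCriterion_bounded₂`), `5 ∣ Δ ∧ 5 ∤ c₄`, `E[5]` irreducible
(`ℓ = 3`, `#Ẽ(𝔽_3) = 4`, `a_3 = 0`). Numbers (binders): `r_an ≤ 1`, `#Ш_an` a `5`-adic unit, and the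
certificate `ord₅ [E(K) : ℤ y_K] ≤ ord₅ c_q` — intended instance `q = 5` (Kodaira `I5`, split, `c_5 = 5`,
`ord₅ = 1`; engine A = Tate's algorithm `tateY` (engine Y verbatim), engine B = PARI `elllocalred`, job
j079111) and `K = ℚ(√-151)`: `m = √(4ρ) = 30`, `ord₅ m = 1` (engine 1 cypari2 job j077797, `N_{E^D} = 131789780`;
engine 2 stdlib job j077967: `m = 30`, AGREE). Per pair; lane books the verdict (literal tier or PUB, with the flags).
[cite: Miller2011LMS, Thm. 5.4 and Def. 1.1] [cite: Cremona2006, Table 1 (Cremona label 5780c1)] -/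
theorem bsdp_j5780c1 (hMJ : thm54_cha_padicValNat_shaOrder_add_tamagawa_le)
    (hGZK : rank_eq_analyticRank_of_analyticRank_le_one)
    (W : WeierstrassCurve ℚ) (hW : W = ⟨0, 0, 0, -272, -1564⟩)
    {N : ℕ} [NeZero N] {K : Type} [Field K] [NumberField K] (hK : IsImaginaryQuadratic K)
    (hH : SatisfiesHeegnerHypothesis N K) {P : (W.baseChange K).toAffine.Point}
    (hP : IsHeegnerPoint N W K P) (hnt : ¬ IsOfFinAddOrder P)
    (hpD : ¬ (5 : ℤ) ∣ NumberField.discr K) (hpN : ¬ 5 ^ 2 ∣ N)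
    (q : ℕ) [Fact q.Prime] (hqN : q ∣ N)
    (hI : padicValNat 5 (AddSubgroup.zmultiples P).index ≤
      padicValNat 5 ((W.baseChange ℚ_[q]).localTamagawaNumber ℤ_[q]))
    (hr : W.analyticRank ≤ 1) {s : ℚ} (hs : shaAn W = (s : ℂ)) (hv : padicValRat 5 s = 0) :
    BSDp W 5 := by
  subst hW
  haveI := isElliptic_of_discOf_ne_zero 0 0 0 (-272) (-1564) (by decide +kernel)
  haveI := isGloballyMinimal_of_krausCriterion_bounded₂ 0 0 0 (-272) (-1564) (by decide +kernel) (by decide +kernel)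
    (by decide +kernel)
  haveI : Fact (Nat.Prime 5) := ⟨by norm_num⟩
  haveI : Fact (Nat.Prime 3) := ⟨by norm_num⟩
  exact bsdp_of_ainvs_of_jetchevChaCertificate hMJ hGZK 0 0 0 (-272) (-1564)
    (integralModelInt_eq_of_map_eq _ (map_mk_int _ _ _ _ _)) 5 3 4 (by decide) (by decide +kernel)
    (by decide +kernel) (by decide) (by decide +kernel) card_j5780c1_3 (by decide +kernel) hK hH hP hnt
    (mod_cast hpD) hpN q hqN hI hr hs hv

/-- **`BSD(E,5)` for `21660u1`** (`N = 21660 = 2^2·3·5·19^2`; `ρ̄_{E,5}` image `5S4`, `nonsplit` multiplicative at `5`, additive at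
`2`, `19`; Tamagawa numbers `c_2 = 3` (IV), `c_3 = 5` (I5, split), `c_5 = 2` (I10, nonsplit), `c_19 = 1` (IV*), `∏ c_q = 30`) from Miller 2011 Thm. 5.4 in the Cha case (FLAGS
`Miller11-Thm54-Cha-case`, `JET@p|N`) + GZK and the Jetchev–Cha index certificate. Kernel: `Δ ≠ 0`,
global minimality (`isGloballyMinimal_of_krausCriterion_bounded₂`), `5 ∣ Δ ∧ 5 ∤ c₄`, `E[5]` irreducible
(`ℓ = 7`, `#Ẽ(𝔽_7) = 13`, `a_7 = -5`). Numbers (binders): `r_an ≤ 1`, `#Ш_an` a `5`-adic unit, and the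
certificate `ord₅ [E(K) : ℤ y_K] ≤ ord₅ c_q` — intended instance `q = 3` (Kodaira `I5`, split, `c_3 = 5`,
`ord₅ = 1`; engine A = Tate's algorithm `tateY` (engine Y verbatim), engine B = PARI `elllocalred`, job
j079111) and `K = ℚ(√-71)`: `m = √(4ρ) = 120`, `ord₅ m = 1` (engine 1 cypari2 job j077800, `N_{E^D} = 109188060`;
engine 2 stdlib job j077971: `m = 120`, AGREE). Per pair; lane books the verdict (literal tier or PUB, with the flags).
[cite: Miller2011LMS, Thm. 5.4 and Def. 1.1] [cite: Cremona2006, Table 1 (Cremona label 21660u1)] -/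
theorem bsdp_j21660u1 (hMJ : thm54_cha_padicValNat_shaOrder_add_tamagawa_le)
    (hGZK : rank_eq_analyticRank_of_analyticRank_le_one)
    (W : WeierstrassCurve ℚ) (hW : W = ⟨0, 1, 0, 1472399, -1009356976⟩)
    {N : ℕ} [NeZero N] {K : Type} [Field K] [NumberField K] (hK : IsImaginaryQuadratic K)
    (hH : SatisfiesHeegnerHypothesis N K) {P : (W.baseChange K).toAffine.Point}
    (hP : IsHeegnerPoint N W K P) (hnt : ¬ IsOfFinAddOrder P)
    (hpD : ¬ (5 : ℤ) ∣ NumberField.discr K) (hpN : ¬ 5 ^ 2 ∣ N)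
    (q : ℕ) [Fact q.Prime] (hqN : q ∣ N)
    (hI : padicValNat 5 (AddSubgroup.zmultiples P).index ≤
      padicValNat 5 ((W.baseChange ℚ_[q]).localTamagawaNumber ℤ_[q]))
    (hr : W.analyticRank ≤ 1) {s : ℚ} (hs : shaAn W = (s : ℂ)) (hv : padicValRat 5 s = 0) :
    BSDp W 5 := by
  subst hW
  haveI := isElliptic_of_discOf_ne_zero 0 1 0 1472399 (-1009356976) (by decide +kernel)
  haveI := isGloballyMinimal_of_krausCriterion_bounded₂ 0 1 0 1472399 (-1009356976) (by decide +kernel) (by decide +kernel)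
    (by decide +kernel)
  haveI : Fact (Nat.Prime 5) := ⟨by norm_num⟩
  haveI : Fact (Nat.Prime 7) := ⟨by norm_num⟩
  exact bsdp_of_ainvs_of_jetchevChaCertificate hMJ hGZK 0 1 0 1472399 (-1009356976)
    (integralModelInt_eq_of_map_eq _ (map_mk_int _ _ _ _ _)) 5 7 13 (by decide) (by decide +kernel)
    (by decide +kernel) (by decide) (by decide +kernel) card_j21660u1_7 (by decide +kernel) hK hH hP hnt
    (mod_cast hpD) hpN q hqN hI hr hs hv

/-- **`BSD(E,5)` for `23120ba1`** (`N = 23120 = 2^4·5·17^2`; `ρ̄_{E,5}` image `5S4`, `split` multiplicative at `5`, additive at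
`2`, `17`; Tamagawa numbers `c_2 = 2` (I0*), `c_5 = 5` (I5, split), `c_17 = 1` (II), `∏ c_q = 10`) from Miller 2011 Thm. 5.4 in the Cha case (FLAGS
`Miller11-Thm54-Cha-case`, `JET@p|N`) + GZK and the Jetchev–Cha index certificate. Kernel: `Δ ≠ 0`,
global minimality (`isGloballyMinimal_of_krausCriterion_bounded₂`), `5 ∣ Δ ∧ 5 ∤ c₄`, `E[5]` irreducible
(`ℓ = 3`, `#Ẽ(𝔽_3) = 4`, `a_3 = 0`). Numbers (binders): `r_an ≤ 1`, `#Ш_an` a `5`-adic unit, and the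
certificate `ord₅ [E(K) : ℤ y_K] ≤ ord₅ c_q` — intended instance `q = 5` (Kodaira `I5`, split, `c_5 = 5`,
`ord₅ = 1`; engine A = Tate's algorithm `tateY` (engine Y verbatim), engine B = PARI `elllocalred`, job
j079111) and `K = ℚ(√-111)`: `m = √(4ρ) = 40`, `ord₅ m = 1` (engine 1 cypari2 job j077797, `N_{E^D} = 284861520`;
engine 2 stdlib job j077972: `m = 40`, AGREE). Per pair; lane books the verdict (literal tier or PUB, with the flags).
[cite: Miller2011LMS, Thm. 5.4 and Def. 1.1] [cite: Cremona2006, Table 1 (Cremona label 23120ba1)] -/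
theorem bsdp_j23120ba1 (hMJ : thm54_cha_padicValNat_shaOrder_add_tamagawa_le)
    (hGZK : rank_eq_analyticRank_of_analyticRank_le_one)
    (W : WeierstrassCurve ℚ) (hW : W = ⟨0, 0, 0, -272, 1564⟩)
    {N : ℕ} [NeZero N] {K : Type} [Field K] [NumberField K] (hK : IsImaginaryQuadratic K)
    (hH : SatisfiesHeegnerHypothesis N K) {P : (W.baseChange K).toAffine.Point}
    (hP : IsHeegnerPoint N W K P) (hnt : ¬ IsOfFinAddOrder P)
    (hpD : ¬ (5 : ℤ) ∣ NumberField.discr K) (hpN : ¬ 5 ^ 2 ∣ N)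
    (q : ℕ) [Fact q.Prime] (hqN : q ∣ N)
    (hI : padicValNat 5 (AddSubgroup.zmultiples P).index ≤
      padicValNat 5 ((W.baseChange ℚ_[q]).localTamagawaNumber ℤ_[q]))
    (hr : W.analyticRank ≤ 1) {s : ℚ} (hs : shaAn W = (s : ℂ)) (hv : padicValRat 5 s = 0) :
    BSDp W 5 := by
  subst hW
  haveI := isElliptic_of_discOf_ne_zero 0 0 0 (-272) 1564 (by decide +kernel)
  haveI := isGloballyMinimal_of_krausCriterion_bounded₂ 0 0 0 (-272) 1564 (by decide +kernel) (by decide +kernel)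
    (by decide +kernel)
  haveI : Fact (Nat.Prime 5) := ⟨by norm_num⟩
  haveI : Fact (Nat.Prime 3) := ⟨by norm_num⟩
  exact bsdp_of_ainvs_of_jetchevChaCertificate hMJ hGZK 0 0 0 (-272) 1564
    (integralModelInt_eq_of_map_eq _ (map_mk_int _ _ _ _ _)) 5 3 4 (by decide) (by decide +kernel)
    (by decide +kernel) (by decide) (by decide +kernel) card_j23120ba1_3 (by decide +kernel) hK hH hP hnt
    (mod_cast hpD) hpN q hqN hI hr hs hv

/-- **`BSD(E,5)` for `25920cm1`** (`N = 25920 = 2^6·3^4·5`; `ρ̄_{E,5}` image `5S4`, `split` multiplicative at `5`, additive at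
`2`, `3`; Tamagawa numbers `c_2 = 1` (II*), `c_3 = 1` (II), `c_5 = 5` (I5, split), `∏ c_q = 5`) from Miller 2011 Thm. 5.4 in the Cha case (FLAGS
`Miller11-Thm54-Cha-case`, `JET@p|N`) + GZK and the Jetchev–Cha index certificate. Kernel: `Δ ≠ 0`,
global minimality (`isGloballyMinimal_of_krausCriterion_bounded₂`), `5 ∣ Δ ∧ 5 ∤ c₄`, `E[5]` irreducible
(`ℓ = 7`, `#Ẽ(𝔽_7) = 8`, `a_7 = 0`). Numbers (binders): `r_an ≤ 1`, `#Ш_an` a `5`-adic unit, and the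
certificate `ord₅ [E(K) : ℤ y_K] ≤ ord₅ c_q` — intended instance `q = 5` (Kodaira `I5`, split, `c_5 = 5`,
`ord₅ = 1`; engine A = Tate's algorithm `tateY` (engine Y verbatim), engine B = PARI `elllocalred`, job
j079111) and `K = ℚ(√-71)`: `m = √(4ρ) = 10`, `ord₅ m = 1` (engine 1 cypari2 job j077800, `N_{E^D} = 130662720`;
engine 2 stdlib job j077966: `m = 10`, AGREE). Per pair; lane books the verdict (literal tier or PUB, with the flags).
[cite: Miller2011LMS, Thm. 5.4 and Def. 1.1] [cite: Cremona2006, Table 1 (Cremona label 25920cm1)] -/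
theorem bsdp_j25920cm1 (hMJ : thm54_cha_padicValNat_shaOrder_add_tamagawa_le)
    (hGZK : rank_eq_analyticRank_of_analyticRank_le_one)
    (W : WeierstrassCurve ℚ) (hW : W = ⟨0, 0, 0, -3792, 89824⟩)
    {N : ℕ} [NeZero N] {K : Type} [Field K] [NumberField K] (hK : IsImaginaryQuadratic K)
    (hH : SatisfiesHeegnerHypothesis N K) {P : (W.baseChange K).toAffine.Point}
    (hP : IsHeegnerPoint N W K P) (hnt : ¬ IsOfFinAddOrder P)
    (hpD : ¬ (5 : ℤ) ∣ NumberField.discr K) (hpN : ¬ 5 ^ 2 ∣ N)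
    (q : ℕ) [Fact q.Prime] (hqN : q ∣ N)
    (hI : padicValNat 5 (AddSubgroup.zmultiples P).index ≤
      padicValNat 5 ((W.baseChange ℚ_[q]).localTamagawaNumber ℤ_[q]))
    (hr : W.analyticRank ≤ 1) {s : ℚ} (hs : shaAn W = (s : ℂ)) (hv : padicValRat 5 s = 0) :
    BSDp W 5 := by
  subst hW
  haveI := isElliptic_of_discOf_ne_zero 0 0 0 (-3792) 89824 (by decide +kernel)
  haveI := isGloballyMinimal_of_krausCriterion_bounded₂ 0 0 0 (-3792) 89824 (by decide +kernel) (by decide +kernel)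
    (by decide +kernel)
  haveI : Fact (Nat.Prime 5) := ⟨by norm_num⟩
  haveI : Fact (Nat.Prime 7) := ⟨by norm_num⟩
  exact bsdp_of_ainvs_of_jetchevChaCertificate hMJ hGZK 0 0 0 (-3792) 89824
    (integralModelInt_eq_of_map_eq _ (map_mk_int _ _ _ _ _)) 5 7 8 (by decide) (by decide +kernel)
    (by decide +kernel) (by decide) (by decide +kernel) card_j25920cm1_7 (by decide +kernel) hK hH hP hnt
    (mod_cast hpD) hpN q hqN hI hr hs hv

/-- **`BSD(E,5)` for `51840bo1`** (`N = 51840 = 2^7·3^4·5`; `ρ̄_{E,5}` image `5S4`, `split` multiplicative at `5`, additive at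
`2`, `3`; Tamagawa numbers `c_2 = 1` (II), `c_3 = 1` (II*), `c_5 = 5` (I5, split), `∏ c_q = 5`) from Miller 2011 Thm. 5.4 in the Cha case (FLAGS
`Miller11-Thm54-Cha-case`, `JET@p|N`) + GZK and the Jetchev–Cha index certificate. Kernel: `Δ ≠ 0`,
global minimality (`isGloballyMinimal_of_krausCriterion_bounded₂`), `5 ∣ Δ ∧ 5 ∤ c₄`, `E[5]` irreducible
(`ℓ = 11`, `#Ẽ(𝔽_11) = 8`, `a_11 = 4`). Numbers (binders): `r_an ≤ 1`, `#Ш_an` a `5`-adic unit, and the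
certificate `ord₅ [E(K) : ℤ y_K] ≤ ord₅ c_q` — intended instance `q = 5` (Kodaira `I5`, split, `c_5 = 5`,
`ord₅ = 1`; engine A = Tate's algorithm `tateY` (engine Y verbatim), engine B = PARI `elllocalred`, job
j079111) and `K = ℚ(√-71)`: `m = √(4ρ) = 30`, `ord₅ m = 1` (engine 1 cypari2 job j077797, `N_{E^D} = 261325440`;
engine 2 stdlib job j077972: `m = 30`, AGREE). Per pair; lane books the verdict (literal tier or PUB, with the flags).
[cite: Miller2011LMS, Thm. 5.4 and Def. 1.1] [cite: Cremona2006, Table 1 (Cremona label 51840bo1)] -/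
theorem bsdp_j51840bo1 (hMJ : thm54_cha_padicValNat_shaOrder_add_tamagawa_le)
    (hGZK : rank_eq_analyticRank_of_analyticRank_le_one)
    (W : WeierstrassCurve ℚ) (hW : W = ⟨0, 0, 0, -1377, 29646⟩)
    {N : ℕ} [NeZero N] {K : Type} [Field K] [NumberField K] (hK : IsImaginaryQuadratic K)
    (hH : SatisfiesHeegnerHypothesis N K) {P : (W.baseChange K).toAffine.Point}
    (hP : IsHeegnerPoint N W K P) (hnt : ¬ IsOfFinAddOrder P)
    (hpD : ¬ (5 : ℤ) ∣ NumberField.discr K) (hpN : ¬ 5 ^ 2 ∣ N)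
    (q : ℕ) [Fact q.Prime] (hqN : q ∣ N)
    (hI : padicValNat 5 (AddSubgroup.zmultiples P).index ≤
      padicValNat 5 ((W.baseChange ℚ_[q]).localTamagawaNumber ℤ_[q]))
    (hr : W.analyticRank ≤ 1) {s : ℚ} (hs : shaAn W = (s : ℂ)) (hv : padicValRat 5 s = 0) :
    BSDp W 5 := by
  subst hW
  haveI := isElliptic_of_discOf_ne_zero 0 0 0 (-1377) 29646 (by decide +kernel)
  haveI := isGloballyMinimal_of_krausCriterion_bounded₂ 0 0 0 (-1377) 29646 (by decide +kernel) (by decide +kernel)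
    (by decide +kernel)
  haveI : Fact (Nat.Prime 5) := ⟨by norm_num⟩
  haveI : Fact (Nat.Prime 11) := ⟨by norm_num⟩
  exact bsdp_of_ainvs_of_jetchevChaCertificate hMJ hGZK 0 0 0 (-1377) 29646
    (integralModelInt_eq_of_map_eq _ (map_mk_int _ _ _ _ _)) 5 11 8 (by decide) (by decide +kernel)
    (by decide +kernel) (by decide) (by decide +kernel) card_j51840bo1_11 (by decide +kernel) hK hH hP hnt
    (mod_cast hpD) hpN q hqN hI hr hs hv

/-- **`BSD(E,5)` for `52020bk1`** (`N = 52020 = 2^2·3^2·5·17^2`; `ρ̄_{E,5}` image `5S4`, `split` multiplicative at `5`, additive at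
`2`, `3`, `17`; Tamagawa numbers `c_2 = 1` (IV*), `c_3 = 2` (I0*), `c_5 = 5` (I5, split), `c_17 = 3` (IV*), `∏ c_q = 30`) from Miller 2011 Thm. 5.4 in the Cha case (FLAGS
`Miller11-Thm54-Cha-case`, `JET@p|N`) + GZK and the Jetchev–Cha index certificate. Kernel: `Δ ≠ 0`,
global minimality (`isGloballyMinimal_of_krausCriterion_bounded₂`), `5 ∣ Δ ∧ 5 ∤ c₄`, `E[5]` irreducible
(`ℓ = 11`, `#Ẽ(𝔽_11) = 11`, `a_11 = 1`). Numbers (binders): `r_an ≤ 1`, `#Ш_an` a `5`-adic unit, and the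
certificate `ord₅ [E(K) : ℤ y_K] ≤ ord₅ c_q` — intended instance `q = 5` (Kodaira `I5`, split, `c_5 = 5`,
`ord₅ = 1`; engine A = Tate's algorithm `tateY` (engine Y verbatim), engine B = PARI `elllocalred`, job
j079111) and `K = ℚ(√-191)`: `m = √(4ρ) = 60`, `ord₅ m = 1` (engine 1 cypari2 job j077800, `N_{E^D} = 1897741620`;
engine 2 stdlib job j077966: `m = 60`, AGREE). Per pair; lane books the verdict (literal tier or PUB, with the flags).
[cite: Miller2011LMS, Thm. 5.4 and Def. 1.1] [cite: Cremona2006, Table 1 (Cremona label 52020bk1)] -/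
theorem bsdp_j52020bk1 (hMJ : thm54_cha_padicValNat_shaOrder_add_tamagawa_le)
    (hGZK : rank_eq_analyticRank_of_analyticRank_le_one)
    (W : WeierstrassCurve ℚ) (hW : W = ⟨0, 0, 0, -707472, 207466164⟩)
    {N : ℕ} [NeZero N] {K : Type} [Field K] [NumberField K] (hK : IsImaginaryQuadratic K)
    (hH : SatisfiesHeegnerHypothesis N K) {P : (W.baseChange K).toAffine.Point}
    (hP : IsHeegnerPoint N W K P) (hnt : ¬ IsOfFinAddOrder P)
    (hpD : ¬ (5 : ℤ) ∣ NumberField.discr K) (hpN : ¬ 5 ^ 2 ∣ N)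
    (q : ℕ) [Fact q.Prime] (hqN : q ∣ N)
    (hI : padicValNat 5 (AddSubgroup.zmultiples P).index ≤
      padicValNat 5 ((W.baseChange ℚ_[q]).localTamagawaNumber ℤ_[q]))
    (hr : W.analyticRank ≤ 1) {s : ℚ} (hs : shaAn W = (s : ℂ)) (hv : padicValRat 5 s = 0) :
    BSDp W 5 := by
  subst hW
  haveI := isElliptic_of_discOf_ne_zero 0 0 0 (-707472) 207466164 (by decide +kernel)
  haveI := isGloballyMinimal_of_krausCriterion_bounded₂ 0 0 0 (-707472) 207466164 (by decide +kernel) (by decide +kernel)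
    (by decide +kernel)
  haveI : Fact (Nat.Prime 5) := ⟨by norm_num⟩
  haveI : Fact (Nat.Prime 11) := ⟨by norm_num⟩
  exact bsdp_of_ainvs_of_jetchevChaCertificate hMJ hGZK 0 0 0 (-707472) 207466164
    (integralModelInt_eq_of_map_eq _ (map_mk_int _ _ _ _ _)) 5 11 11 (by decide) (by decide +kernel)
    (by decide +kernel) (by decide) (by decide +kernel) card_j52020bk1_11 (by decide +kernel) hK hH hP hnt
    (mod_cast hpD) hpN q hqN hI hr hs hv

/-- **`BSD(E,5)` for `59040bf1`** (`N = 59040 = 2^5·3^2·5·41`; `ρ̄_{E,5}` image `5Ns`, `nonsplit` multiplicative at `5`, additive at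
`2`, `3`; Tamagawa numbers `c_2 = 1` (I0*), `c_3 = 2` (III*), `c_5 = 1` (I5, nonsplit), `c_41 = 5` (I5, split), `∏ c_q = 10`) from Miller 2011 Thm. 5.4 in the Cha case (FLAGS
`Miller11-Thm54-Cha-case`, `JET@p|N`) + GZK and the Jetchev–Cha index certificate. Kernel: `Δ ≠ 0`,
global minimality (`isGloballyMinimal_of_krausCriterion_bounded₂`), `5 ∣ Δ ∧ 5 ∤ c₄`, `E[5]` irreducible
(`ℓ = 7`, `#Ẽ(𝔽_7) = 3`, `a_7 = 5`). Numbers (binders): `r_an ≤ 1`, `#Ш_an` a `5`-adic unit, and the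
certificate `ord₅ [E(K) : ℤ y_K] ≤ ord₅ c_q` — intended instance `q = 41` (Kodaira `I5`, split, `c_41 = 5`,
`ord₅ = 1`; engine A = Tate's algorithm `tateY` (engine Y verbatim), engine B = PARI `elllocalred`, job
j079111) and `K = ℚ(√-119)`: `m = √(4ρ) = 60`, `ord₅ m = 1` (engine 1 cypari2 job j077797, `N_{E^D} = 836065440`;
engine 2 stdlib job j077968: `m = 60`, AGREE). Per pair; lane books the verdict (literal tier or PUB, with the flags).
[cite: Miller2011LMS, Thm. 5.4 and Def. 1.1] [cite: Cremona2006, Table 1 (Cremona label 59040bf1)] -/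
theorem bsdp_j59040bf1 (hMJ : thm54_cha_padicValNat_shaOrder_add_tamagawa_le)
    (hGZK : rank_eq_analyticRank_of_analyticRank_le_one)
    (W : WeierstrassCurve ℚ) (hW : W = ⟨0, 0, 0, -1709883, -865485918⟩)
    {N : ℕ} [NeZero N] {K : Type} [Field K] [NumberField K] (hK : IsImaginaryQuadratic K)
    (hH : SatisfiesHeegnerHypothesis N K) {P : (W.baseChange K).toAffine.Point}
    (hP : IsHeegnerPoint N W K P) (hnt : ¬ IsOfFinAddOrder P)
    (hpD : ¬ (5 : ℤ) ∣ NumberField.discr K) (hpN : ¬ 5 ^ 2 ∣ N)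
    (q : ℕ) [Fact q.Prime] (hqN : q ∣ N)
    (hI : padicValNat 5 (AddSubgroup.zmultiples P).index ≤
      padicValNat 5 ((W.baseChange ℚ_[q]).localTamagawaNumber ℤ_[q]))
    (hr : W.analyticRank ≤ 1) {s : ℚ} (hs : shaAn W = (s : ℂ)) (hv : padicValRat 5 s = 0) :
    BSDp W 5 := by
  subst hW
  haveI := isElliptic_of_discOf_ne_zero 0 0 0 (-1709883) (-865485918) (by decide +kernel)
  haveI := isGloballyMinimal_of_krausCriterion_bounded₂ 0 0 0 (-1709883) (-865485918) (by decide +kernel) (by decide +kernel)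
    (by decide +kernel)
  haveI : Fact (Nat.Prime 5) := ⟨by norm_num⟩
  haveI : Fact (Nat.Prime 7) := ⟨by norm_num⟩
  exact bsdp_of_ainvs_of_jetchevChaCertificate hMJ hGZK 0 0 0 (-1709883) (-865485918)
    (integralModelInt_eq_of_map_eq _ (map_mk_int _ _ _ _ _)) 5 7 3 (by decide) (by decide +kernel)
    (by decide +kernel) (by decide) (by decide +kernel) card_j59040bf1_7 (by decide +kernel) hK hH hP hnt
    (mod_cast hpD) hpN q hqN hI hr hs hv

end Summit.BirchSwinnertonDyer.Rank1Residual.X11b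

end
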